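import Summits.CriticalPhenomena.PercolationContinuityZ3.Theorems.PercNearOneGluingNoHeavyQuantFarSunLaw
import Summits.CriticalPhenomena.PercolationContinuityZ3.Theorems.PercNearOneGluingNoHeavyQuantFarHairyCycleLeSeven
import HarnessLib

/-!
# FAR beyond trees: `HairyCycle.SunFAR K j` HOLDS FOR `2 ≤ K ≤ 7` AT EVERY LAYER (the sun certificates, read back to law level)

builds on p205010 (kernel theorem, internal audit signed; external expert review pending)

Support file (`--supports stmt-CriticalPhenomena-4575`), seat `prim-cert-1` (gen 20); QUANT lane rung R8, front "FAR beyond trees" (lead g22).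
By the converse bridge `HairyCycle.sunFAR_of_farp_sun` (`…QuantFarSunLaw`: every law-level datum is realised by a weight function of the sun
graph), the exact relay-set-level sun certificates of gen 18 (`farp_sun_three`, …, `farp_sun_seven`: `TwoCopy.FARp` on `sunEs K` for every weight
function, `K = 3, …, 7`, every layer; `K = 2` is the trivial layer `0` / cardinality case) give the ELEMENTARY inequality `SunFAR K j` for
`2 ≤ K ≤ 7` and every `j` — the first rungs of the all-`K` target `∀ K, SunFAR K 1` of the layer-one programme.  Computational by inheritance
(the certificate checks are `native_decide` / Kronecker checks in the imported files).  No sorries.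
* `sunFAR_two` — `K = 2` (no certificate needed); `sunFAR_of_le_seven` — `2 ≤ K ≤ 7`, every layer `j`.
[cite: KozmaNitzan2024, Conjecture 3 (p. 15)] (the row); [this work].
-/

noncomputable section

namespace Summit.CriticalPhenomena.PercolationContinuityZ3.Theorems.HairyCycle

open Finset MeasureTheory
open Literature.Probability.Percolation Literature.Probability.LatticeModels
open Summit.CriticalPhenomena.PercolationContinuityZ3.Theorems.AdditiveGluing.Negative.Cert
open Summit.CriticalPhenomena.PercolationContinuityZ3.Theorems.TwoCopy
open scoped Classical

/-- `SunFAR 2 j` for every `j`: with two relays only layer `0` is non-vacuous, and layer `0` is the union bound. [this work] -/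
theorem sunFAR_two (j : ℕ) : SunFAR 2 j := by
  refine sunFAR_of_farp_sun (le_refl 2) fun q _ => ?_
  rcases Nat.eq_zero_or_pos j with hj | hj
  · subst hj
    exact FARp.zero q _ _
  · exact FARp.of_card_le q _ _ j (Finset.card_image_le.trans (by rw [Finset.card_range]; omega))

/-- **`SunFAR K j` for `2 ≤ K ≤ 7` and every layer `j`** — the sun certificates of gen 18 at law level. [this work] -/
theorem sunFAR_of_le_seven {K : ℕ} (hK2 : 2 ≤ K) (hK7 : K ≤ 7) (j : ℕ) : SunFAR K j := by
  interval_cases K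
  · exact sunFAR_two j
  · exact sunFAR_of_farp_sun (by norm_num) fun q hq => farp_sun_three j q hq
  · exact sunFAR_of_farp_sun (by norm_num) fun q hq => farp_sun_four j q hq
  · exact sunFAR_of_farp_sun (by norm_num) fun q hq => farp_sun_five j q hq
  · exact sunFAR_of_farp_sun (by norm_num) fun q hq => farp_sun_six j q hq
  · exact sunFAR_of_farp_sun (by norm_num) fun q hq => farp_sun_seven j q hq

end Summit.CriticalPhenomena.PercolationContinuityZ3.Theorems.HairyCycle

end
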